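/-
Copyright (c) 2026 the pub-hodgecm-mathlib formalisation cell (harness21).  Prover seat hodgecm-mathlib-F0P3-p01 (g31), «(D-RAM) FOUR-FRAME» road of crux H413, line LH4, MS ROAD A,
STAGE B ∕ B56₂ (G-socket₂ assembly, dealer WORD #26 (2)), FILE W: THE PLAIN-WEIGHT SUM OVER THE TYPE-2 GLUED STRATUM `(2ρ+1, 2ρ+1+s, 2ρ+1+s)` (reading (ii), multiplicity-free).
2026-09-04.
-/
import Summits.HodgeConjecture.HodgeConjecture.Theorems.F0P3cDyRamDiagonalGluedTubeContributionCorner   -- ★ p856265 (this seat): tube Σw, empty regimes (type-2 letters)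
import Summits.HodgeConjecture.HodgeConjecture.Theorems.F0P3cDyRamDiagonalGluedFootContributionCorner   -- ★ p856276 (this seat): foot Σw ∕ 0 (type-2 letters)
import Summits.HodgeConjecture.HodgeConjecture.Theorems.F0P3cDyRamDiagonalGluedRhoZero                  -- ★ p856296 (this seat): ρ = 0 root-glued Σw, stability
import Summits.HodgeConjecture.HodgeConjecture.Theorems.F0P3cDyRamDiagonalGluedStratumTwo               -- ★ F1₂ (this seat): `stratumTwo_G1_eq`, `stratumTwo_G1_zero_eq`, `…_empty_of_odd`
import Summits.HodgeConjecture.HodgeConjecture.Theorems.F0P3cDyRamDiagonalGluedTubeCriterionTypeTwo      -- ★ p856270 (LH4-p09 (g2)): `isTypeTwoPolarisable_latt_hnf_glued_iff`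
import Summits.HodgeConjecture.HodgeConjecture.Theorems.F0P3cDyRamDiagonalGluedTubeCriterionTypeTwoZero  -- ★ p856303 (LH4-p09 (g2)): `isTypeTwoPolarisable_latt_hnf_glued_zero`
import Summits.HodgeConjecture.HodgeConjecture.Theorems.F0P3cDyRamGlueUnitRationalityDepth              -- ★ p856146 (LH4-p08 (g2)): `exists_fixed_v_add_glueUnit_le_iff`
import Literature.NumberTheory.LocalFields.WildQuadraticDatumTraceBound                               -- ★ (LH4-p07 (g3)): `trace_bound_of_isRamifiedQuadraticDatum`
import Literature.NumberTheory.Automorphic.UnitaryThreeFourFrameFixedCosetDictionary                   -- ★ `v_eq_one_of_mul_map_eq_one`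
import HarnessLib

/-!
# Crux `H413`, MS ROAD A, STAGE B ∕ B56₂, FILE W: `Σᶠ_{M ∈ stratumTwo (2ρ+1, 2ρ+1+s, 2ρ+1+s)} 1∕[𝒰_F : S_F(M)]` — the multiplicity-free mass of the type-2 glued stratum

Cell `hodgecm-mathlib` (D-0151), FLOOR 0, crux item H413 = `stmt-HodgeConjecture-24833`; lane `--supports stmt-HodgeConjecture-24833 --as helper` (count-neutral).  THEOREMS ONLY
(no `def`, no instance, no notation, no `sorry`).  The G-socket₂ of LH4-p10 (g2)'s re-keyed Stage B₂ (reading (iii), LEAD R-21) is `Σᶠ_{M ∈ stratumTwo σ ϖ T (2ρ+1, 2ρ+1+s, 2ρ+1+s)}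
n₂(M)·w(M)`; this file delivers its MULTIPLICITY-FREE factor `Σᶠ w` in closed form (reading (ii)), with the binders of `B10-StableCountTypeTwo.SKELETON.v1` (08e5e6e2) `stub_B56_G1`
(`hD h2 hE hN₀ hT ρ s hs`), so that the socket is `n₂(ρ) · (this file)` once LH4-p08 (g3)'s per-stratum values `n₂ = q^{1 − ρ % 2}` (ρ ≥ 1) ∕ `q − 1` (ρ = 0) land (FILE M, next).
THE CASE TREE (twin of ★ p856234 `F0P3cDyRamDiagonalGluedSocket`, LH4-p08 (g2), type 0).  `s` odd ⇒ empty (★ F1₂).  `s = 2t`, `ρ ≥ 1`: ★ F1₂ `stratumTwo_G1_eq` + ★ p856270 (polarisable ⟺ (R))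
make the stratum the glued `T`-stable (R)-family `gluedR`; TUBE `2ρ+1+2t ≤ n₁ ∧ 2ρ+1 ≤ n₂` (⇒ `2ρ+1 ≤ n₃`, isoceles) ⇒ ★ p856265 `Σ w = (q−1)q^{2ρ+t−1+ρ%2}`; OFF THE FOOT below the tube ⇒
★ `gluedR_stable_eq_empty_of_offFoot_corner`; ON THE FOOT (`n₂ = n₃ = m < 2ρ+1`, `n₁ = m+2t`): `m ≤ ρ` ⇒ EMPTY (`gluedR_stable_eq_empty_of_lt_typeTwo`: stability needs `|β−1| ≤ |ϖ|^{ρ+2t+1}`,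
★ p856176); `ρ+1 ≤ m` ⇒ ★ p856276 `Σ w = q^{ρ+t+(m+1)∕2−1+ρ%2}` or `0` by the rationality switch ★ `exists_fixed_v_add_glueUnit_le_iff` ⟺ `2ρ+1−m ≤ m−d+1`.  `ρ = 0`: ★ F1₂
`stratumTwo_G1_zero_eq` + ★ p856303 (every root-glued frame is polarisable) + ★ p856296 (`Σ w = q^{t}` on the tube `1+2t ≤ n₁`, unstable below it).
HEADS: **`finsum_stabiliserWeight_stratumTwo_G1`** (ρ ≥ 1) and **`finsum_stabiliserWeight_stratumTwo_G1_zero`** (ρ = 0).  Multiplying by `n₂(ρ)` gives the skeleton₂ RHS: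
`q^{1−ρ%2}·(q−1)q^{2ρ+t−1+ρ%2} = (q−1)q^{2ρ+t}`, `q^{1−ρ%2}·q^{ρ+t+(m+1)∕2−1+ρ%2} = q^{2ρ+1+t−⌈(2ρ+1−m)∕2⌉}`, `(q−1)·q^{t}` — LH4-p10 TABLES ∕ LH4-r01 (g3) DX 01:10:36Z.
HONEST LABEL.  Count-neutral (`--supports`); the census laws (MS) stay PROVER TARGETS; `HC_CM` is proved only modulo the 7 printed citations (2 remaining named inputs: hLiu418 =
`stmt-HodgeConjecture-24832`, h413 = `stmt-HodgeConjecture-24833`) until rung 0 closes.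

## References
* [Kottwitz1986BaseChangeUnits] R. E. Kottwitz, *Base change for unit elements of Hecke algebras*, Compositio Math. 60 (1986), §1 pp. 240–241 (fixed-lattice counts via torus orbits).
* [Rogawski1990] J. D. Rogawski, *Automorphic Representations of Unitary Groups in Three Variables*, Ann. of Math. Stud. 123 (1990), §4.9 Prop. 4.9.1 (a) p. 55.
-/

set_option autoImplicit false

noncomputable section

namespace Summit.HodgeConjecture.HodgeConjecture.Cruxes.H413.F0P3cDyRamDiagonalGluedSocketTwoWeight

open Matrix
open Literature.NumberTheory.Automorphic Literature.NumberTheory.Automorphic.HermitianLattice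
open Literature.NumberTheory.Automorphic.UnitaryLatticeTree Literature.NumberTheory.Automorphic.UnitaryThreeFourFrame
open Literature.NumberTheory.LocalFields.WildQuadraticDatum
open Summit.HodgeConjecture.HodgeConjecture.Cruxes.H413.F0P3cDyRamDiagonalTorusDefs
open Summit.HodgeConjecture.HodgeConjecture.Cruxes.H413.F0P3cDyRamDiagonalStrataDefs
open Summit.HodgeConjecture.HodgeConjecture.Cruxes.H413.F0P3cDyRamDiagonalGluedStabiliserIndex (ne_zero_and_v_lt_one_of_v_eq_exp)
open Summit.HodgeConjecture.HodgeConjecture.Cruxes.H413.F0P3cDyRamDiagonalGluedStabilityCorner (mapGL_latt_hnf_glued_corner_eq_iff)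
open Summit.HodgeConjecture.HodgeConjecture.Cruxes.H413.F0P3cDyRamDiagonalGluedTubeContributionCorner
open Summit.HodgeConjecture.HodgeConjecture.Cruxes.H413.F0P3cDyRamDiagonalGluedFootContributionCorner
open Summit.HodgeConjecture.HodgeConjecture.Cruxes.H413.F0P3cDyRamDiagonalGluedRhoZero
open Summit.HodgeConjecture.HodgeConjecture.Cruxes.H413.F0P3cDyRamDiagonalGluedStratumTwo
open Summit.HodgeConjecture.HodgeConjecture.Cruxes.H413.F0P3cDyRamDiagonalGluedTubeCriterionTypeTwo (isTypeTwoPolarisable_latt_hnf_glued_iff)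
open Summit.HodgeConjecture.HodgeConjecture.Cruxes.H413.F0P3cDyRamDiagonalGluedTubeCriterionTypeTwoZero (isTypeTwoPolarisable_latt_hnf_glued_zero)
open Summit.HodgeConjecture.HodgeConjecture.Cruxes.H413.F0P3cDyRamGlueUnitRationalityDepth (exists_fixed_v_add_glueUnit_le_iff)
open scoped Valued WithZero Matrix MatrixGroups

section Conversions

variable {K : Type*} [Field K] [Valued K ℤᵐ⁰]

/-- **POLARISABLE = (R) ON THE GLUED TYPE-2 FAMILY** (set form of ★ p856270 `isTypeTwoPolarisable_latt_hnf_glued_iff`): the glued `T`-stable type-2-polarisable lattices with letters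
`(ρ, 2t)` are the glued `T`-stable lattices satisfying `(R)`: `∃ f = σf, |ζ·σy″ − σx·f| ≤ |ϖ|^{ρ+2t}`. [cite: Kottwitz1986BaseChangeUnits, §1 pp. 240–241] -/
theorem gluedPol_eq_gluedR {σ : K →+* K} (hσ : ∀ a, σ (σ a) = a) (hvσ : ∀ a, Valued.v (σ a) = Valued.v a)
    {ϖ : K} (hϖ0 : ϖ ≠ 0) (hϖ1 : Valued.v ϖ < 1) (hTr : ∀ a : K, Valued.v (a + σ a) ≤ Valued.v ϖ * Valued.v a) (T : GL (Fin 3) K)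
    (ρ t : ℕ) (hρ : 1 ≤ ρ) (ht : 1 ≤ t) :
    {M : Submodule 𝒪[K] (Fin 3 → K) | ∃ x ζ y'' : K, Valued.v x = 1 ∧ Valued.v ζ = 1 ∧ Valued.v y'' = Valued.v ϖ ^ (2 * t) ∧
        M = latt (!![1, 0, 0; x, ϖ ^ ρ, 0; x * ζ + y'', ϖ ^ ρ * ζ, ϖ ^ (2 * ρ + 1 + 2 * t)] : Matrix (Fin 3) (Fin 3) K) ∧ mapGL T M = M ∧
        IsTypeTwoPolarisable σ ϖ M} =
    {M : Submodule 𝒪[K] (Fin 3 → K) | ∃ x ζ y'' : K, Valued.v x = 1 ∧ Valued.v ζ = 1 ∧ Valued.v y'' = Valued.v ϖ ^ (2 * t) ∧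
        M = latt (!![1, 0, 0; x, ϖ ^ ρ, 0; x * ζ + y'', ϖ ^ ρ * ζ, ϖ ^ (2 * ρ + 2 * t + 1)] : Matrix (Fin 3) (Fin 3) K) ∧ mapGL T M = M ∧
        ∃ f : K, σ f = f ∧ Valued.v (ζ * σ y'' - σ x * f) ≤ Valued.v ϖ ^ (ρ + 2 * t)} := by
  have e : 2 * ρ + 1 + 2 * t = 2 * ρ + 2 * t + 1 := by ring
  ext M
  constructor
  · rintro ⟨x, ζ, y'', hx, hζ, hy'', rfl, hTM, hpol⟩
    have hdet : (!![1, 0, 0; x, ϖ ^ ρ, 0; x * ζ + y'', ϖ ^ ρ * ζ, ϖ ^ (2 * ρ + 1 + 2 * t)] : Matrix (Fin 3) (Fin 3) K).det ≠ 0 := by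
      rw [Matrix.det_fin_three]; simp [hϖ0]
    have key := (isTypeTwoPolarisable_latt_hnf_glued_iff hσ hvσ hϖ0 hϖ1 hTr ρ (2 * t) hρ (dvd_mul_right 2 t) (by omega) hx hζ hy''
      (Matrix.GeneralLinearGroup.mkOfDetNeZero _ hdet) rfl).1 hpol
    rw [e] at hTM ⊢
    exact ⟨x, ζ, y'', hx, hζ, hy'', rfl, hTM, key⟩
  · rintro ⟨x, ζ, y'', hx, hζ, hy'', rfl, hTM, f, hf, hR⟩
    have hdet : (!![1, 0, 0; x, ϖ ^ ρ, 0; x * ζ + y'', ϖ ^ ρ * ζ, ϖ ^ (2 * ρ + 1 + 2 * t)] : Matrix (Fin 3) (Fin 3) K).det ≠ 0 := by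
      rw [Matrix.det_fin_three]; simp [hϖ0]
    have key := (isTypeTwoPolarisable_latt_hnf_glued_iff hσ hvσ hϖ0 hϖ1 hTr ρ (2 * t) hρ (dvd_mul_right 2 t) (by omega) hx hζ hy''
      (Matrix.GeneralLinearGroup.mkOfDetNeZero _ hdet) rfl).2 ⟨f, hf, hR⟩
    rw [← e] at hTM ⊢
    exact ⟨x, ζ, y'', hx, hζ, hy'', rfl, hTM, key⟩

/-- **TOO SHALLOW FOR TYPE 2: `n₁ < ρ + 2t + 1` ⇒ NO STABLE GLUED LATTICE** (★ p856176 `mapGL_latt_hnf_glued_corner_eq_iff`, second conjunct `|(β−1)ζ| ≤ |ϖ|^{ρ+2t+1}`; covers the foot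
`n₂ = n₃ = m ≤ ρ`, `n₁ = m + 2t`, where the type-2 glue regime `ρ+1 ≤ m` of ★ p856276 has not begun). [cite: Kottwitz1986BaseChangeUnits, §1 pp. 240–241] -/
theorem gluedR_stable_eq_empty_of_lt_typeTwo (σ : K →+* K) {ϖ : K} (hϖ : Valued.v ϖ = WithZero.exp (-1 : ℤ)) {α β : K} (hα : Valued.v α = 1) (hβ : Valued.v β = 1)
    (T : GL (Fin 3) K) (hT : (T : Matrix (Fin 3) (Fin 3) K) = Matrix.diagonal ![α, β, 1]) {n₁ : ℕ} (h₁ : Valued.v (β - 1) = Valued.v ϖ ^ n₁)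
    (ρ t : ℕ) (hlt : n₁ < ρ + 2 * t + 1) :
    {M : Submodule 𝒪[K] (Fin 3 → K) | ∃ x ζ y'' : K, Valued.v x = 1 ∧ Valued.v ζ = 1 ∧ Valued.v y'' = Valued.v ϖ ^ (2 * t) ∧
        M = latt (!![1, 0, 0; x, ϖ ^ ρ, 0; x * ζ + y'', ϖ ^ ρ * ζ, ϖ ^ (2 * ρ + 2 * t + 1)] : Matrix (Fin 3) (Fin 3) K) ∧ mapGL T M = M ∧
        ∃ f : K, σ f = f ∧ Valued.v (ζ * σ y'' - σ x * f) ≤ Valued.v ϖ ^ (ρ + 2 * t)} = ∅ := by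
  obtain ⟨hϖ0, hϖ1⟩ := ne_zero_and_v_lt_one_of_v_eq_exp hϖ
  refine Set.eq_empty_iff_forall_notMem.2 ?_
  rintro M ⟨x, ζ, y'', hx, hζ, -, rfl, hTM, -⟩
  have hdet : (!![1, 0, 0; x, ϖ ^ ρ, 0; x * ζ + y'', ϖ ^ ρ * ζ, ϖ ^ (2 * ρ + 2 * t + 1)] : Matrix (Fin 3) (Fin 3) K).det ≠ 0 := by
    rw [Matrix.det_fin_three]; simp [hϖ0]
  have h := ((mapGL_latt_hnf_glued_corner_eq_iff hϖ0 hα hβ T hT ρ (2 * t) 1 x ζ y'' (Matrix.GeneralLinearGroup.mkOfDetNeZero _ hdet) rfl).1 hTM).2.1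
  rw [map_mul, hζ, mul_one, h₁] at h
  have := (pow_le_pow_iff_right_of_lt_one₀ ((Valuation.pos_iff _).2 hϖ0) hϖ1).1 h
  omega

/-- **AT ρ = 0 EVERY STABLE ROOT-GLUED FRAME IS TYPE-2 POLARISABLE** (set form of ★ p856303 `isTypeTwoPolarisable_latt_hnf_glued_zero`; `s ≥ 2` even): the polarisability
conjunct of ★ F1₂ `stratumTwo_G1_zero_eq` drops. [cite: Kottwitz1986BaseChangeUnits, §1 pp. 240–241] -/
theorem rootPol_eq_root {σ : K →+* K} (hσ : ∀ a, σ (σ a) = a) (hvσ : ∀ a, Valued.v (σ a) = Valued.v a)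
    {ϖ : K} (hϖ0 : ϖ ≠ 0) (hϖ1 : Valued.v ϖ < 1) (T : GL (Fin 3) K) (s : ℕ) (hs2 : 2 ∣ s) (hs : 1 ≤ s) :
    {M : Submodule 𝒪[K] (Fin 3 → K) | ∃ y ζ : K, Valued.v ζ = 1 ∧ Valued.v y = Valued.v ϖ ^ s ∧
        M = latt (!![1, 0, 0; 0, 1, 0; y, ζ, ϖ ^ (1 + s)] : Matrix (Fin 3) (Fin 3) K) ∧ mapGL T M = M ∧ IsTypeTwoPolarisable σ ϖ M} =
    {M : Submodule 𝒪[K] (Fin 3 → K) | ∃ y ζ : K, Valued.v ζ = 1 ∧ Valued.v y = Valued.v ϖ ^ s ∧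
        M = latt (!![1, 0, 0; 0, 1, 0; y, ζ, ϖ ^ (1 + s)] : Matrix (Fin 3) (Fin 3) K) ∧ mapGL T M = M} := by
  ext M
  constructor
  · rintro ⟨y, ζ, hζ, hy, rfl, hTM, -⟩
    exact ⟨y, ζ, hζ, hy, rfl, hTM⟩
  · rintro ⟨y, ζ, hζ, hy, rfl, hTM⟩
    have hdet : (!![1, 0, 0; 0, 1, 0; y, ζ, ϖ ^ (1 + s)] : Matrix (Fin 3) (Fin 3) K).det ≠ 0 := by
      rw [Matrix.det_fin_three]; simp [hϖ0]
    exact ⟨y, ζ, hζ, hy, rfl, hTM,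
      isTypeTwoPolarisable_latt_hnf_glued_zero hσ hvσ hϖ0 hϖ1 s hs2 hs hζ hy (Matrix.GeneralLinearGroup.mkOfDetNeZero _ hdet) rfl⟩

end Conversions

section Socket

variable {K : Type} [Field K] [Valued K ℤᵐ⁰] [Fintype 𝓀[K]] {σ : K →+* K} {ϖ : K} {d t : ℕ} {α β : K} {N₀ n₁ n₂ n₃ : ℕ} {T : GL (Fin 3) K}

/-- **THE PLAIN-WEIGHT MASS OF THE TYPE-2 GLUED STRATUM, `ρ ≥ 1`** (axis `(2ρ+1, 2ρ+1+s, 2ρ+1+s)`, binders of skeleton₂ `stub_B56_G1`): TUBE `(q−1)·q^{2ρ+s∕2−1+ρ%2}` iff `s` even,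
`2ρ+1 ≤ min(n₂,n₃)`, `2ρ+1+s ≤ n₁`; GLUE `q^{ρ+s∕2+(n₂+1)∕2−1+ρ%2}` iff `s` even, `n₂ = n₃ =: m`, `n₁ = m+s`, `m < 2ρ+1`, `2ρ+1 ≤ 2m`, `2ρ+1−m ≤ m−d+1`.  Times the polarisation
count `n₂ = q^{1−ρ%2}` this is skeleton₂'s `(q−1)q^{2ρ+s∕2} + q^{2ρ+1+s∕2−⌈(2ρ+1−m)∕2⌉}`. [cite: Kottwitz1986BaseChangeUnits, §1 pp. 240–241] [cite: Rogawski1990, §4.9 Prop. 4.9.1 (a) p. 55] -/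
theorem finsum_stabiliserWeight_stratumTwo_G1 (hD : IsRamifiedQuadraticDatum σ ϖ d t) (h2 : Valued.v (2 : K) < 1) (hE : IsElementDatum σ ϖ N₀ α β n₁ n₂ n₃) (hN₀ : d ≤ N₀)
    (hT : (T : Matrix (Fin 3) (Fin 3) K) = Matrix.diagonal ![α, β, 1]) (ρ s : ℕ) (hρ : 1 ≤ ρ) (hs : 1 ≤ s) :
    ∑ᶠ M ∈ stratumTwo σ ϖ T ![2 * ρ + 1, 2 * ρ + 1 + s, 2 * ρ + 1 + s], stabiliserWeight σ M =
      (if 2 ∣ s ∧ 2 * ρ + 1 ≤ min n₂ n₃ ∧ 2 * ρ + 1 + s ≤ n₁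
        then (((Fintype.card 𝓀[K] : ℚ) - 1) * (Fintype.card 𝓀[K] : ℚ) ^ (2 * ρ + s / 2 - 1 + ρ % 2)) else 0) +
      (if 2 ∣ s ∧ n₂ = n₃ ∧ n₁ = n₂ + s ∧ n₂ < 2 * ρ + 1 ∧ 2 * ρ + 1 ≤ 2 * n₂ ∧ 2 * ρ + 1 - n₂ ≤ n₂ - d + 1
        then ((Fintype.card 𝓀[K] : ℚ) ^ (ρ + s / 2 + (n₂ + 1) / 2 - 1 + ρ % 2)) else 0) := by
  have hTr := trace_bound_of_isRamifiedQuadraticDatum hD h2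
  obtain ⟨hσ, hvσ, hϖ, hfix, hd, h1d, -⟩ := hD
  obtain ⟨hαn, hβn, -, hα1, hβ1, h₁, h₂, h₃, hN1, hN2, hN3⟩ := hE
  have hα := v_eq_one_of_mul_map_eq_one hvσ hαn
  have hβ := v_eq_one_of_mul_map_eq_one hvσ hβn
  have h₃' : Valued.v (β - α) = Valued.v ϖ ^ n₃ := by rw [Valuation.map_sub_swap, h₃]
  obtain ⟨hϖ0, hϖ1⟩ := ne_zero_and_v_lt_one_of_v_eq_exp hϖ
  obtain ⟨hi1, hi2, -⟩ := isoceles_depths hϖ h₁ h₂ h₃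
  rw [← Nat.card_eq_fintype_card]
  by_cases hpar : 2 ∣ s
  · obtain ⟨t', rfl⟩ := hpar
    have ht' : 1 ≤ t' := by omega
    rw [show 2 * t' / 2 = t' by omega, stratumTwo_G1_eq hvσ hfix hϖ T hρ hs, gluedPol_eq_gluedR hσ hvσ hϖ0 hϖ1 hTr T ρ t' hρ ht']
    by_cases htube : 2 * ρ + 2 * t' + 1 ≤ n₁ ∧ 2 * ρ + 1 ≤ n₂
    · -- THE TUBE
      have hn₃ : 2 * ρ + 1 ≤ n₃ := le_trans (le_min (by omega) htube.2) hi1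
      have e : 2 * ρ + 2 * t' + 1 = 2 * ρ + 1 + 2 * t' := by ring
      have htube_sum := finsum_stabiliserWeight_gluedR_tube_typeTwo_eq hσ hvσ hfix hϖ hd hα hβ T hT h₁ h₂ h₃' ρ t' hρ (by omega) htube.2 (by omega)
      rw [← e] at htube_sum
      rw [htube_sum, if_pos ⟨dvd_mul_right 2 t', le_min htube.2 hn₃, by omega⟩, if_neg (fun h => absurd h.2.2.2.1 (not_lt.2 htube.2)), add_zero]
    · rw [if_neg (fun h => htube ⟨by omega, (le_min_iff.1 h.2.1).1⟩), zero_add]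
      by_cases hfoot : n₁ = n₂ + 2 * t'
      · -- ON THE FOOT: `n₃ = n₂ < 2ρ+1`
        have hn₃ : n₃ = n₂ := by
          rcases min_le_iff.1 hi1 with h | h <;> rcases min_le_iff.1 hi2 with h' | h' <;> omega
        subst hn₃
        have hm : n₃ < 2 * ρ + 1 := by
          by_contra hge
          exact htube ⟨by omega, not_lt.1 hge⟩
        rw [hfoot] at h₁
        by_cases hρm : ρ + 1 ≤ n₃
        · -- THE GLUE REGIME `ρ+1 ≤ m < 2ρ+1`
          have hvϖ0 : Valued.v ϖ ≠ 0 := (Valuation.ne_zero_iff _).2 hϖ0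
          have h₁' : Valued.v (β - 1) = Valued.v ϖ ^ (n₃ + 2 * t') := h₁
          have hg : Valued.v ((β - 1) / (α - 1)) = Valued.v ϖ ^ (2 * t') := by
            rw [map_div₀, h₁', h₂, pow_add, mul_div_cancel_left₀ _ (pow_ne_zero n₃ hvϖ0)]
          have hαd : Valued.v (α - 1) ≤ Valued.v ϖ ^ d := by rw [h₂]; exact pow_le_pow_right_of_le_one' hϖ1.le (by omega)
          have hβd : Valued.v (β - 1) ≤ Valued.v ϖ ^ d := by rw [h₁']; exact pow_le_pow_right_of_le_one' hϖ1.le (by omega)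
          have hswitch := exists_fixed_v_add_glueUnit_le_iff hσ hvσ hfix hϖ hd h1d hαn hβn hα1 hβ1 hαd hβd h₃ (by omega) hg
            (by omega : 2 * t' ≤ 2 * ρ + 2 * t' + 1 - n₃)
          by_cases hrat : ∃ f : K, σ f = f ∧ Valued.v (f + (β - 1) / (α - 1)) ≤ Valued.v ϖ ^ (2 * ρ + 2 * t' + 1 - n₃)
          · obtain ⟨f₀, hσf₀, hf₀⟩ := hrat
            have hle : 2 * ρ + 1 - n₃ ≤ n₃ - d + 1 := by have := hswitch.1 ⟨f₀, hσf₀, hf₀⟩; omega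
            rw [finsum_stabiliserWeight_gluedR_foot_typeTwo_eq hσ hvσ hfix hϖ hd hα hβ T hT ρ t' n₃ hρ h₁' h₂ h₃' hρm hm hσf₀ hf₀,
              if_pos ⟨dvd_mul_right 2 t', rfl, hfoot, hm, by omega, hle⟩]
          · rw [finsum_stabiliserWeight_gluedR_foot_typeTwo_eq_zero hσ hvσ hfix hϖ hd hα hβ T hT ρ t' n₃ hρ h₁' h₂ h₃' hρm hm hrat,
              if_neg (fun h => hrat (hswitch.2 (by have := h.2.2.2.2.2; omega)))]
        · -- TOO SHALLOW FOR TYPE 2: `m ≤ ρ`, `n₁ = m + 2t < ρ + 2t + 1`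
          rw [gluedR_stable_eq_empty_of_lt_typeTwo σ hϖ hα hβ T hT h₁ ρ t' (by omega), finsum_mem_empty,
            if_neg (fun h => by have := h.2.2.2.2.1; omega)]
      · -- OFF THE FOOT, BELOW THE TUBE: nothing
        rw [gluedR_stable_eq_empty_of_offFoot_corner σ hϖ0 hϖ1 hα hβ T hT h₁ h₂ ρ t' 1 hfoot (fun h => htube ⟨by omega, by omega⟩), finsum_mem_empty,
          if_neg (fun h => hfoot h.2.2.1)]
  · -- `s` ODD: the stratum is empty
    rw [stratumTwo_G1_eq_empty_of_odd hvσ hfix hϖ T hpar, finsum_mem_empty, if_neg (fun h => hpar h.1), if_neg (fun h => hpar h.1), add_zero]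

/-- **THE PLAIN-WEIGHT MASS OF THE ROOT-GLUED TYPE-2 STRATUM, `ρ = 0`** (axis `(1, 1+s, 1+s)`, written `(2·0+1, 2·0+1+s, 2·0+1+s)` to plug into the `ρ`-indexed socket): `q^{s∕2}` iff `s`
is even and `1+s ≤ n₁` (then `1 ≤ n₂, n₃` is automatic from the element datum, `d ≥ 1`), else `0` — every stable root-glued frame is polarisable (★ p856303), the torus acts with one
orbit (★ p856296).  Times the polarisation count `n₂ = q − 1` this is skeleton₂'s `(q−1)·q^{s∕2}`; the glue summand is void at `ρ = 0` (`n₂ < 1 ≤ N₀`). [cite: Kottwitz1986BaseChangeUnits, §1 pp. 240–241] -/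
theorem finsum_stabiliserWeight_stratumTwo_G1_zero (hD : IsRamifiedQuadraticDatum σ ϖ d t) (hE : IsElementDatum σ ϖ N₀ α β n₁ n₂ n₃) (hN₀ : d ≤ N₀)
    (hT : (T : Matrix (Fin 3) (Fin 3) K) = Matrix.diagonal ![α, β, 1]) (s : ℕ) (hs : 1 ≤ s) :
    ∑ᶠ M ∈ stratumTwo σ ϖ T ![2 * 0 + 1, 2 * 0 + 1 + s, 2 * 0 + 1 + s], stabiliserWeight σ M =
      if 2 ∣ s ∧ 1 + s ≤ n₁ then ((Fintype.card 𝓀[K] : ℚ) ^ (s / 2)) else 0 := by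
  obtain ⟨hσ, hvσ, hϖ, hfix, hd, h1d, -⟩ := hD
  obtain ⟨hαn, hβn, -, -, -, h₁, h₂, -, hN1, hN2, -⟩ := hE
  have hα := v_eq_one_of_mul_map_eq_one hvσ hαn
  have hβ := v_eq_one_of_mul_map_eq_one hvσ hβn
  obtain ⟨hϖ0, hϖ1⟩ := ne_zero_and_v_lt_one_of_v_eq_exp hϖ
  rw [← Nat.card_eq_fintype_card]
  by_cases hpar : 2 ∣ s
  · rw [stratumTwo_G1_zero_eq hvσ hfix hϖ T hs]
    simp only [Nat.mul_zero, Nat.zero_add]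
    rw [rootPol_eq_root hσ hvσ hϖ0 hϖ1 T s hpar hs]
    by_cases htube : 1 + s ≤ n₁
    · rw [finsum_stabiliserWeight_rhoZero_tube_typeTwo_eq hσ hvσ hfix hϖ hd hα hβ T hT h₁ h₂ s hpar htube (by omega), if_pos ⟨hpar, htube⟩]
    · -- BELOW THE TUBE: no stable root-glued frame
      have he : {M : Submodule 𝒪[K] (Fin 3 → K) | ∃ y ζ : K, Valued.v ζ = 1 ∧ Valued.v y = Valued.v ϖ ^ s ∧
          M = latt (!![1, 0, 0; 0, 1, 0; y, ζ, ϖ ^ (1 + s)] : Matrix (Fin 3) (Fin 3) K) ∧ mapGL T M = M} = ∅ := by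
        refine Set.eq_empty_iff_forall_notMem.2 ?_
        rintro M ⟨y, ζ, hζ, -, rfl, hTM⟩
        have hdet : (!![1, 0, 0; 0, 1, 0; y, ζ, ϖ ^ (1 + s)] : Matrix (Fin 3) (Fin 3) K).det ≠ 0 := by
          rw [Matrix.det_fin_three]; simp [hϖ0]
        exact not_mapGL_latt_rhoZero_eq_of_lt hϖ hα hβ T hT h₁ (not_le.1 htube) hζ (Matrix.GeneralLinearGroup.mkOfDetNeZero _ hdet) rfl hTM
      rw [he, finsum_mem_empty, if_neg (fun h => htube h.2)]
  · rw [stratumTwo_G1_eq_empty_of_odd hvσ hfix hϖ T hpar, finsum_mem_empty, if_neg (fun h => hpar h.1)]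

end Socket

end Summit.HodgeConjecture.HodgeConjecture.Cruxes.H413.F0P3cDyRamDiagonalGluedSocketTwoWeight

end
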